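import Literature.AlgebraicGeometry.ShimuraVarieties.UnitaryCurveAuxiliaryFrameReadoutDatum   -- ★ §7 the frame readout datum (imports FILE A, FILE B I+II)
import HarnessLib

/-!
# The Hecke-neighbour lattice counts in the E1 symplectic frame, I: `[𝔭_{u₀}⁻¹Λ_{b a} : Λ_{b a}] = q²`, stability and exhaustion
# ([Shimura 1971] §3.2 Lemma 3.23; [Milne 2005] §6 Thm. 6.11 p. 74 and p. 75: (L-c′) of the P6 Hecke-roof census in FRAME currency)

Topic `AlgebraicGeometry/ShimuraVarieties`; namespace `Literature.AlgebraicGeometry.ShimuraVarieties.UnitaryCurve.AuxV`.  THEOREMS ONLY (no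
definition, no named fact, no instance, no notation, no `sorry`).  Cell `hodgecm-mathlib` (D-0151), FLOOR 0, P6 «MOD programme», crux item
stmt-HodgeConjecture-24832 (hLiu418), X-LEAF socket `stub_EHECKE`, organ (O-L) part 2 = FILE B (DEAL L5-#6, LA5-p02 (g3)), §8 (i): the abstract
heads of ★ `TwistedFrameLatticeCounts` fed with the frame readout datum ★ `UnitaryCurveAuxiliaryFrameReadoutDatum` — in the currency of the E-side
Hecke roofs (`Λ_{b x} = latticeOfGL ↑(ũ_{Fr}(x, 1))`, integral frame reading `ρ : 𝓞_F →+* M_{2g}(ℤ)`, ★ (L-a)(L-b)), for a split place `u₀` of good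
reduction at a hyperspecial level (`u₀ = w̄ = c⁻¹w` via ★ `splitHyperspecialData_inv_smul`) with place idempotent `ε = 1_{u₀}`:

* `latticeOfGL_auxToGspFinV_mulVec_mem` — `Λ_{b a}` is `ρ(𝓞_F)`-stable; `latticeOfGL_auxToGspFinV_le_idealInv` — `Λ_{b a} ≤ 𝔭_{u₀}⁻¹Λ_{b a}`.
* **`relIndex_latticeOfGL_auxToGspFinV_idealInv_eq_sq` — (L-c′) `[𝔭_{u₀}⁻¹Λ_{b a} : Λ_{b a}] = q²`**, `q = #(𝓞_F ∕ 𝔭_{u₀})`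
  (`𝔭⁻¹Λ := {v | ρ(π) v ∈ Λ ∀ π ∈ 𝔭}`, any `ℤ`-submodule with this membership, ★ `exists_submodule_forall_mulVec_mem`).
* **`exists_eq_of_injective_heckeNeighbour_auxToGspFinV` — EXHAUSTION**: `q + 1` injective `ρ`-stable index-`q` lattices between `Λ_{b a}` and
  `𝔭_{u₀}⁻¹Λ_{b a}` are all of them — the `hexh` input of ★ `SiegelAdelicMarkingStableLines.exists_stableLines` with `M b := (ρ b).map Int.cast`,
  `𝔞 := 𝔭_{u₀}`, `n := q`.

## References
* [ShimuraIATAF1971] G. Shimura, *Introduction to the Arithmetic Theory of Automorphic Functions* (1971), §3.2 (Lemma 3.22–3.23).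
* [Milne2005ShimuraVarieties] J. S. Milne, *Introduction to Shimura varieties* (2005), §4 pp. 48–49, §6 Thm. 6.11 p. 74 and p. 75.
* [DiamondShurman2005] F. Diamond, J. Shurman, *A First Course in Modular Forms* (2005), §5.2.
* [Deligne1971TravauxShimura] P. Deligne, *Travaux de Shimura*, Sém. Bourbaki 389 (1971), 4.11–4.12, Exemple 4.16 p. 150.

#harness_tags number_theory.shimura_varieties, number_theory.adeles, linear_algebra.lattices
-/

set_option autoImplicit false

noncomputable section

open Matrix NumberField IsDedekindDomain MulAction
open scoped TensorProduct RestrictedProduct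
open Literature.AlgebraicGeometry.ModuliOfAbelianVarieties Literature.LinearAlgebra.FreeModule
open Literature.NumberTheory.Automorphic (integralFiniteAdeles glInt mem_glInt_iff)
open Literature.NumberTheory.Adeles (latticeOfGL mem_latticeOfGL_iff)
open Literature.NumberTheory.Adeles.Readout (exists_submodule_forall_mulVec_mem mulVec_mem_latticeOfGL_map latticeOfGL_map_le_idealInv
  relIndex_latticeOfGL_map_idealInv_eq_sq exists_eq_of_injective_heckeNeighbour)

namespace Literature.AlgebraicGeometry.ShimuraVarieties

namespace UnitaryCurve

namespace AuxV

open Literature.AlgebraicGeometry.ShimuraVarieties.UnitaryCanonicalModel.Aux (ratBasis torusFinAdelic torusToTensorFin finAdeleToTensor)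
open Literature.NumberTheory.Automorphic Literature.NumberTheory.Automorphic.UnitaryGroup

variable {F : Type} [Field F] [NumberField F] [IsCMField F] {Jstar : Matrix (Fin 2) (Fin 2) F} {ξ : F} {g : ℕ} {δ : Fin g → ℕ}

/-! ### §1 `Λ_{b a}` is `ρ`-stable and sits inside `𝔭⁻¹Λ_{b a}` -/

/-- **`Λ_{b a}` IS `ρ(𝓞_F)`-STABLE** (frame currency; ★ `mulVec_mem_latticeOfGL_map` through ★ `exists_frameReadingHom`).
[cite: Milne2005ShimuraVarieties, §4 pp. 48–49] [cite: ShimuraIATAF1971, §3.2] -/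
theorem latticeOfGL_auxToGspFinV_mulVec_mem
    (Fr : SymplecticFrameV F (RingHom.id F) Jstar ξ g δ)
    (γ : GL (Fin 2 × Fin (Module.finrank ℚ F)) ℚ)
    (T : Matrix (Fin g ⊕ Fin g) (Fin 2 × Fin (Module.finrank ℚ F)) ℤ) (T' : Matrix (Fin 2 × Fin (Module.finrank ℚ F)) (Fin g ⊕ Fin g) ℤ) (hT'T : T' * T = 1)
    (hP : framePV Fr = T.map (Int.cast : ℤ → ℚ) * ((γ : GL (Fin 2 × Fin (Module.finrank ℚ F)) ℚ) : Matrix (Fin 2 × Fin (Module.finrank ℚ F)) (Fin 2 × Fin (Module.finrank ℚ F)) ℚ))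
    (hγS : ∀ b : 𝓞 F, ∀ i i', ∃ z : ℤ,
      (((γ : GL (Fin 2 × Fin (Module.finrank ℚ F)) ℚ) : Matrix (Fin 2 × Fin (Module.finrank ℚ F)) (Fin 2 × Fin (Module.finrank ℚ F)) ℚ) *
            resMatrix (m := Fin 2) (ratBasis F) (((b : 𝓞 F) : F) • (1 : Matrix (Fin 2) (Fin 2) F)) *
          ((γ⁻¹ : GL (Fin 2 × Fin (Module.finrank ℚ F)) ℚ) : Matrix (Fin 2 × Fin (Module.finrank ℚ F)) (Fin 2 × Fin (Module.finrank ℚ F)) ℚ)) i i' = (z : ℚ))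
    (ρ : 𝓞 F →+* Matrix (Fin g ⊕ Fin g) (Fin g ⊕ Fin g) ℤ)
    (hρ : ∀ b : 𝓞 F, (ρ b).map (Int.cast : ℤ → ℚ) =
      framePV Fr * resMatrix (m := Fin 2) (ratBasis F) (((b : 𝓞 F) : F) • (1 : Matrix (Fin 2) (Fin 2) F)) * frameQV Fr)
    (a : ↥(finAdelic (↥(maximalRealSubfield F)) F (IsCMField.complexConj F) 2 Jstar)) (b : 𝓞 F) {v : Fin g ⊕ Fin g → ℚ} (hv : v ∈ latticeOfGL ((auxToGspFinV Fr (a, 1) : ↥(gspFinAdelic δ)) : GL (Fin g ⊕ Fin g) finAdeleQ)) :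
    (ρ b).map (Int.cast : ℤ → ℚ) *ᵥ v ∈ latticeOfGL ((auxToGspFinV Fr (a, 1) : ↥(gspFinAdelic δ)) : GL (Fin g ⊕ Fin g) finAdeleQ) := by
  obtain ⟨A, hA, hAu⟩ := exists_frameReadingHom Fr
  have h := mulVec_mem_latticeOfGL_map A
    (fun b' z hz => by rw [hA]; exact frame_integral_algebraMap_smul_one_mulVec Fr γ T T' hT'T hP hγS b' z hz)
    ((Int.castRingHom ℚ).mapMatrix.comp ρ) (fun b' => by rw [hA]; exact frame_reading_map_algebraMap Fr ρ hρ b')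
    (a : GL (Fin 2) (FiniteAdeleRing (𝓞 F) F)) b (q := v) (by rw [hAu]; exact hv)
  rw [hAu] at h
  exact h

/-- **`Λ_{b a} ≤ 𝔭⁻¹Λ_{b a}`** for any ideal-inverse lattice `𝔭⁻¹Λ_{b a} = {v | ρ(π) v ∈ Λ_{b a} ∀ π ∈ 𝔭}`. [cite: ShimuraIATAF1971, §3.2] -/
theorem latticeOfGL_auxToGspFinV_le_idealInv
    (Fr : SymplecticFrameV F (RingHom.id F) Jstar ξ g δ)
    (γ : GL (Fin 2 × Fin (Module.finrank ℚ F)) ℚ)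
    (T : Matrix (Fin g ⊕ Fin g) (Fin 2 × Fin (Module.finrank ℚ F)) ℤ) (T' : Matrix (Fin 2 × Fin (Module.finrank ℚ F)) (Fin g ⊕ Fin g) ℤ) (hT'T : T' * T = 1)
    (hP : framePV Fr = T.map (Int.cast : ℤ → ℚ) * ((γ : GL (Fin 2 × Fin (Module.finrank ℚ F)) ℚ) : Matrix (Fin 2 × Fin (Module.finrank ℚ F)) (Fin 2 × Fin (Module.finrank ℚ F)) ℚ))
    (hγS : ∀ b : 𝓞 F, ∀ i i', ∃ z : ℤ,
      (((γ : GL (Fin 2 × Fin (Module.finrank ℚ F)) ℚ) : Matrix (Fin 2 × Fin (Module.finrank ℚ F)) (Fin 2 × Fin (Module.finrank ℚ F)) ℚ) *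
            resMatrix (m := Fin 2) (ratBasis F) (((b : 𝓞 F) : F) • (1 : Matrix (Fin 2) (Fin 2) F)) *
          ((γ⁻¹ : GL (Fin 2 × Fin (Module.finrank ℚ F)) ℚ) : Matrix (Fin 2 × Fin (Module.finrank ℚ F)) (Fin 2 × Fin (Module.finrank ℚ F)) ℚ)) i i' = (z : ℚ))
    (ρ : 𝓞 F →+* Matrix (Fin g ⊕ Fin g) (Fin g ⊕ Fin g) ℤ)
    (hρ : ∀ b : 𝓞 F, (ρ b).map (Int.cast : ℤ → ℚ) =
      framePV Fr * resMatrix (m := Fin 2) (ratBasis F) (((b : 𝓞 F) : F) • (1 : Matrix (Fin 2) (Fin 2) F)) * frameQV Fr)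
    (𝔭 : Ideal (𝓞 F)) (a : ↥(finAdelic (↥(maximalRealSubfield F)) F (IsCMField.complexConj F) 2 Jstar)) (L' : Submodule ℤ (Fin g ⊕ Fin g → ℚ))
    (hL' : ∀ v : Fin g ⊕ Fin g → ℚ, v ∈ L' ↔ ∀ π ∈ 𝔭, (ρ π).map (Int.cast : ℤ → ℚ) *ᵥ v ∈ latticeOfGL ((auxToGspFinV Fr (a, 1) : ↥(gspFinAdelic δ)) : GL (Fin g ⊕ Fin g) finAdeleQ)) :
    latticeOfGL ((auxToGspFinV Fr (a, 1) : ↥(gspFinAdelic δ)) : GL (Fin g ⊕ Fin g) finAdeleQ) ≤ L' :=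
  fun _ hv => (hL' _).2 fun π _ => latticeOfGL_auxToGspFinV_mulVec_mem Fr γ T T' hT'T hP hγS ρ hρ a π hv

/-! ### §2 (L-c′) `[𝔭_{u₀}⁻¹Λ_{b a} : Λ_{b a}] = q²` and exhaustion -/

omit [IsCMField F] in
/-- The place idempotent is idempotent. [folklore] -/
private theorem idempotent_mul_self {u₀ : HeightOneSpectrum (𝓞 F)} (ε : FiniteAdeleRing (𝓞 F) F) (hε₁ : ε u₀ = 1)
    (hε₀ : ∀ u, u ≠ u₀ → ε u = 0) : ε * ε = ε := by
  refine FiniteAdeleRing.ext _ fun u => ?_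
  change ε u * ε u = ε u
  by_cases h : u = u₀
  · subst h; rw [hε₁, mul_one]
  · rw [hε₀ u h, mul_zero]

/-- **(L-c′) `[𝔭_{u₀}⁻¹Λ_{b a} : Λ_{b a}] = q²` IN FRAME CURRENCY** (`q = #(𝓞_F ∕ 𝔭_{u₀})`, `u₀` split of good reduction at the hyperspecial level `K`):
★ `relIndex_latticeOfGL_map_idealInv_eq_sq` fed with the frame readout datum (★ `exists_frameReadingHom`, ★ `exists_frame_localCoord_normalForm`).
[cite: ShimuraIATAF1971, §3.2 Lemma 3.23] [cite: Milne2005ShimuraVarieties, §6 Thm. 6.11 p. 74 and p. 75] -/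
theorem relIndex_latticeOfGL_auxToGspFinV_idealInv_eq_sq
    (Fr : SymplecticFrameV F (RingHom.id F) Jstar ξ g δ)
    (γ : GL (Fin 2 × Fin (Module.finrank ℚ F)) ℚ)
    (T : Matrix (Fin g ⊕ Fin g) (Fin 2 × Fin (Module.finrank ℚ F)) ℤ) (T' : Matrix (Fin 2 × Fin (Module.finrank ℚ F)) (Fin g ⊕ Fin g) ℤ) (hTT' : T * T' = 1) (hT'T : T' * T = 1)
    (hP : framePV Fr = T.map (Int.cast : ℤ → ℚ) * ((γ : GL (Fin 2 × Fin (Module.finrank ℚ F)) ℚ) : Matrix (Fin 2 × Fin (Module.finrank ℚ F)) (Fin 2 × Fin (Module.finrank ℚ F)) ℚ))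
    (hγS : ∀ b : 𝓞 F, ∀ i i', ∃ z : ℤ,
      (((γ : GL (Fin 2 × Fin (Module.finrank ℚ F)) ℚ) : Matrix (Fin 2 × Fin (Module.finrank ℚ F)) (Fin 2 × Fin (Module.finrank ℚ F)) ℚ) *
            resMatrix (m := Fin 2) (ratBasis F) (((b : 𝓞 F) : F) • (1 : Matrix (Fin 2) (Fin 2) F)) *
          ((γ⁻¹ : GL (Fin 2 × Fin (Module.finrank ℚ F)) ℚ) : Matrix (Fin 2 × Fin (Module.finrank ℚ F)) (Fin 2 × Fin (Module.finrank ℚ F)) ℚ)) i i' = (z : ℚ))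
    (ρ : 𝓞 F →+* Matrix (Fin g ⊕ Fin g) (Fin g ⊕ Fin g) ℤ)
    (hρ : ∀ b : 𝓞 F, (ρ b).map (Int.cast : ℤ → ℚ) =
      framePV Fr * resMatrix (m := Fin 2) (ratBasis F) (((b : 𝓞 F) : F) • (1 : Matrix (Fin 2) (Fin 2) F)) * frameQV Fr)
    (K : Subgroup ↥(finAdelic (↥(maximalRealSubfield F)) F (IsCMField.complexConj F) 2 Jstar))
    (hγ : ∀ p ∈ K.prod (⊥ : Subgroup ↥(torusFinAdelic F)),
      (∀ i i', ((Matrix.GeneralLinearGroup.map (algebraMap ℚ finAdeleQ) γ * auxResFinV F (RingHom.id F) Jstar p *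
          (Matrix.GeneralLinearGroup.map (algebraMap ℚ finAdeleQ) γ)⁻¹ : GL (Fin 2 × Fin (Module.finrank ℚ F)) finAdeleQ) :
            Matrix (Fin 2 × Fin (Module.finrank ℚ F)) (Fin 2 × Fin (Module.finrank ℚ F)) finAdeleQ) i i' ∈ integralFiniteAdeles ℚ) ∧
      (∀ i i', ((Matrix.GeneralLinearGroup.map (algebraMap ℚ finAdeleQ) γ * (auxResFinV F (RingHom.id F) Jstar p)⁻¹ *
          (Matrix.GeneralLinearGroup.map (algebraMap ℚ finAdeleQ) γ)⁻¹ : GL (Fin 2 × Fin (Module.finrank ℚ F)) finAdeleQ) :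
            Matrix (Fin 2 × Fin (Module.finrank ℚ F)) (Fin 2 × Fin (Module.finrank ℚ F)) finAdeleQ) i i' ∈ integralFiniteAdeles ℚ))
    (hJ : (Jstar.map (IsCMField.complexConj F))ᵀ = Jstar)
    {u₀ : HeightOneSpectrum (𝓞 F)} (hu : (IsCMField.complexConj F) • u₀ ≠ u₀) (hJu : IsUnit (placeForm Jstar u₀))
    (hJi : hJu.unit ∈ glInt 2 (u₀.adicCompletion F))
    (hKv : IsHyperspecialAt (↥(maximalRealSubfield F)) F (IsCMField.complexConj F) 2 Jstar K (u₀.under (𝓞 ↥(maximalRealSubfield F))))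
    (ε : FiniteAdeleRing (𝓞 F) F) (hε₁ : ε u₀ = 1) (hε₀ : ∀ u, u ≠ u₀ → ε u = 0)
    (a : ↥(finAdelic (↥(maximalRealSubfield F)) F (IsCMField.complexConj F) 2 Jstar)) (L' : Submodule ℤ (Fin g ⊕ Fin g → ℚ))
    (hL' : ∀ v : Fin g ⊕ Fin g → ℚ, v ∈ L' ↔ ∀ π ∈ u₀.asIdeal, (ρ π).map (Int.cast : ℤ → ℚ) *ᵥ v ∈ latticeOfGL ((auxToGspFinV Fr (a, 1) : ↥(gspFinAdelic δ)) : GL (Fin g ⊕ Fin g) finAdeleQ)) :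
    (latticeOfGL ((auxToGspFinV Fr (a, 1) : ↥(gspFinAdelic δ)) : GL (Fin g ⊕ Fin g) finAdeleQ)).toAddSubgroup.relIndex L'.toAddSubgroup = Nat.card (𝓞 F ⧸ u₀.asIdeal) ^ 2 := by
  obtain ⟨A, hA, hAu⟩ := exists_frameReadingHom Fr
  obtain ⟨θ, hθA, hθsurj, m, hθint⟩ := exists_frame_localCoord_normalForm Fr γ T T' hT'T hP hγS K hγ hJ hu hJu hJi hKv ε hε₁ hε₀
  have hp : Ideal.absNorm u₀.asIdeal ≠ 0 := by rw [Ne, Ideal.absNorm_eq_zero_iff]; exact u₀.ne_bot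
  have h := relIndex_latticeOfGL_map_idealInv_eq_sq A u₀ ε θ m
    (fun z => by rw [hA, hA]; exact frame_integral_iff_integral_place_and_away Fr γ T T' hTT' hT'T hP hγS ε hε₁ hε₀ z)
    (fun z => by rw [hA]; exact hθint z)
    (fun X z => by rw [hA]; exact hθA X z)
    (fun z hz => by rw [hA]; exact frame_integral_away_of_forall_mem_asIdeal Fr γ T T' hT'T hP hγS ε hε₁ hε₀ z (fun π hπ => by rw [← hA]; exact hz π hπ))
    (fun b' z hz => by rw [hA]; exact frame_integral_algebraMap_smul_one_mulVec Fr γ T T' hT'T hP hγS b' z hz)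
    ((Int.castRingHom ℚ).mapMatrix.comp ρ) (fun b' => by rw [hA]; exact frame_reading_map_algebraMap Fr ρ hρ b')
    hθsurj (idempotent_mul_self ε hε₁ hε₀) hε₁ hp (Ideal.absNorm_mem u₀.asIdeal)
    (a : GL (Fin 2) (FiniteAdeleRing (𝓞 F) F)) L' (fun v => by rw [hAu]; exact hL' v)
  rw [hAu] at h
  exact h

/-- **EXHAUSTION IN FRAME CURRENCY**: an injective family of `q + 1` `ρ`-stable lattices `Λ_{b a} ≤ H_i ≤ 𝔭_{u₀}⁻¹Λ_{b a}` of index `q` contains every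
`ρ`-stable index-`q` lattice between `Λ_{b a}` and `𝔭_{u₀}⁻¹Λ_{b a}` — the `hexh` input of ★ `exists_stableLines` (★ `exists_eq_of_injective_heckeNeighbour`
fed with the frame readout datum). [cite: ShimuraIATAF1971, §3.2 Lemma 3.23] [cite: DiamondShurman2005, §5.2] [cite: Milne2005ShimuraVarieties, §6 p. 75] -/
theorem exists_eq_of_injective_heckeNeighbour_auxToGspFinV
    (Fr : SymplecticFrameV F (RingHom.id F) Jstar ξ g δ)
    (γ : GL (Fin 2 × Fin (Module.finrank ℚ F)) ℚ)
    (T : Matrix (Fin g ⊕ Fin g) (Fin 2 × Fin (Module.finrank ℚ F)) ℤ) (T' : Matrix (Fin 2 × Fin (Module.finrank ℚ F)) (Fin g ⊕ Fin g) ℤ) (hTT' : T * T' = 1) (hT'T : T' * T = 1)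
    (hP : framePV Fr = T.map (Int.cast : ℤ → ℚ) * ((γ : GL (Fin 2 × Fin (Module.finrank ℚ F)) ℚ) : Matrix (Fin 2 × Fin (Module.finrank ℚ F)) (Fin 2 × Fin (Module.finrank ℚ F)) ℚ))
    (hγS : ∀ b : 𝓞 F, ∀ i i', ∃ z : ℤ,
      (((γ : GL (Fin 2 × Fin (Module.finrank ℚ F)) ℚ) : Matrix (Fin 2 × Fin (Module.finrank ℚ F)) (Fin 2 × Fin (Module.finrank ℚ F)) ℚ) *
            resMatrix (m := Fin 2) (ratBasis F) (((b : 𝓞 F) : F) • (1 : Matrix (Fin 2) (Fin 2) F)) *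
          ((γ⁻¹ : GL (Fin 2 × Fin (Module.finrank ℚ F)) ℚ) : Matrix (Fin 2 × Fin (Module.finrank ℚ F)) (Fin 2 × Fin (Module.finrank ℚ F)) ℚ)) i i' = (z : ℚ))
    (ρ : 𝓞 F →+* Matrix (Fin g ⊕ Fin g) (Fin g ⊕ Fin g) ℤ)
    (hρ : ∀ b : 𝓞 F, (ρ b).map (Int.cast : ℤ → ℚ) =
      framePV Fr * resMatrix (m := Fin 2) (ratBasis F) (((b : 𝓞 F) : F) • (1 : Matrix (Fin 2) (Fin 2) F)) * frameQV Fr)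
    (K : Subgroup ↥(finAdelic (↥(maximalRealSubfield F)) F (IsCMField.complexConj F) 2 Jstar))
    (hγ : ∀ p ∈ K.prod (⊥ : Subgroup ↥(torusFinAdelic F)),
      (∀ i i', ((Matrix.GeneralLinearGroup.map (algebraMap ℚ finAdeleQ) γ * auxResFinV F (RingHom.id F) Jstar p *
          (Matrix.GeneralLinearGroup.map (algebraMap ℚ finAdeleQ) γ)⁻¹ : GL (Fin 2 × Fin (Module.finrank ℚ F)) finAdeleQ) :
            Matrix (Fin 2 × Fin (Module.finrank ℚ F)) (Fin 2 × Fin (Module.finrank ℚ F)) finAdeleQ) i i' ∈ integralFiniteAdeles ℚ) ∧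
      (∀ i i', ((Matrix.GeneralLinearGroup.map (algebraMap ℚ finAdeleQ) γ * (auxResFinV F (RingHom.id F) Jstar p)⁻¹ *
          (Matrix.GeneralLinearGroup.map (algebraMap ℚ finAdeleQ) γ)⁻¹ : GL (Fin 2 × Fin (Module.finrank ℚ F)) finAdeleQ) :
            Matrix (Fin 2 × Fin (Module.finrank ℚ F)) (Fin 2 × Fin (Module.finrank ℚ F)) finAdeleQ) i i' ∈ integralFiniteAdeles ℚ))
    (hJ : (Jstar.map (IsCMField.complexConj F))ᵀ = Jstar)
    {u₀ : HeightOneSpectrum (𝓞 F)} (hu : (IsCMField.complexConj F) • u₀ ≠ u₀) (hJu : IsUnit (placeForm Jstar u₀))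
    (hJi : hJu.unit ∈ glInt 2 (u₀.adicCompletion F))
    (hKv : IsHyperspecialAt (↥(maximalRealSubfield F)) F (IsCMField.complexConj F) 2 Jstar K (u₀.under (𝓞 ↥(maximalRealSubfield F))))
    (ε : FiniteAdeleRing (𝓞 F) F) (hε₁ : ε u₀ = 1) (hε₀ : ∀ u, u ≠ u₀ → ε u = 0)
    (a : ↥(finAdelic (↥(maximalRealSubfield F)) F (IsCMField.complexConj F) 2 Jstar)) {β : Type*} (hβ : Nat.card β = Nat.card (𝓞 F ⧸ u₀.asIdeal) + 1)
    (Hfam : β → Submodule ℤ (Fin g ⊕ Fin g → ℚ)) (hinj : Function.Injective Hfam)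
    (hΛ : ∀ i, latticeOfGL ((auxToGspFinV Fr (a, 1) : ↥(gspFinAdelic δ)) : GL (Fin g ⊕ Fin g) finAdeleQ) ≤ Hfam i)
    (h𝔭 : ∀ i, ∀ v ∈ Hfam i, ∀ π ∈ u₀.asIdeal, (ρ π).map (Int.cast : ℤ → ℚ) *ᵥ v ∈ latticeOfGL ((auxToGspFinV Fr (a, 1) : ↥(gspFinAdelic δ)) : GL (Fin g ⊕ Fin g) finAdeleQ))
    (hcard : ∀ i, (latticeOfGL ((auxToGspFinV Fr (a, 1) : ↥(gspFinAdelic δ)) : GL (Fin g ⊕ Fin g) finAdeleQ)).toAddSubgroup.relIndex (Hfam i).toAddSubgroup = Nat.card (𝓞 F ⧸ u₀.asIdeal))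
    (hst : ∀ i (b : 𝓞 F), ∀ v ∈ Hfam i, (ρ b).map (Int.cast : ℤ → ℚ) *ᵥ v ∈ Hfam i)
    (L : Submodule ℤ (Fin g ⊕ Fin g → ℚ)) (hL : latticeOfGL ((auxToGspFinV Fr (a, 1) : ↥(gspFinAdelic δ)) : GL (Fin g ⊕ Fin g) finAdeleQ) ≤ L)
    (hL𝔭 : ∀ v ∈ L, ∀ π ∈ u₀.asIdeal, (ρ π).map (Int.cast : ℤ → ℚ) *ᵥ v ∈ latticeOfGL ((auxToGspFinV Fr (a, 1) : ↥(gspFinAdelic δ)) : GL (Fin g ⊕ Fin g) finAdeleQ))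
    (hLcard : (latticeOfGL ((auxToGspFinV Fr (a, 1) : ↥(gspFinAdelic δ)) : GL (Fin g ⊕ Fin g) finAdeleQ)).toAddSubgroup.relIndex L.toAddSubgroup = Nat.card (𝓞 F ⧸ u₀.asIdeal))
    (hLst : ∀ b : 𝓞 F, ∀ v ∈ L, (ρ b).map (Int.cast : ℤ → ℚ) *ᵥ v ∈ L) :
    ∃ i, Hfam i = L := by
  obtain ⟨A, hA, hAu⟩ := exists_frameReadingHom Fr
  obtain ⟨θ, hθA, hθsurj, m, hθint⟩ := exists_frame_localCoord_normalForm Fr γ T T' hT'T hP hγS K hγ hJ hu hJu hJi hKv ε hε₁ hε₀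
  have hp : Ideal.absNorm u₀.asIdeal ≠ 0 := by rw [Ne, Ideal.absNorm_eq_zero_iff]; exact u₀.ne_bot
  have hΛ' : ∀ i, latticeOfGL (Units.map (A : Matrix (Fin 2) (Fin 2) (FiniteAdeleRing (𝓞 F) F) →* Matrix (Fin g ⊕ Fin g) (Fin g ⊕ Fin g) finAdeleQ)
      (a : GL (Fin 2) (FiniteAdeleRing (𝓞 F) F))) ≤ Hfam i := fun i => by rw [hAu]; exact hΛ i
  exact exists_eq_of_injective_heckeNeighbour A u₀ ε θ m
    (fun z => by rw [hA, hA]; exact frame_integral_iff_integral_place_and_away Fr γ T T' hTT' hT'T hP hγS ε hε₁ hε₀ z)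
    (fun z => by rw [hA]; exact hθint z)
    (fun X z => by rw [hA]; exact hθA X z)
    (fun z hz => by rw [hA]; exact frame_integral_away_of_forall_mem_asIdeal Fr γ T T' hT'T hP hγS ε hε₁ hε₀ z (fun π hπ => by rw [← hA]; exact hz π hπ))
    (fun b' z hz => by rw [hA]; exact frame_integral_algebraMap_smul_one_mulVec Fr γ T T' hT'T hP hγS b' z hz)
    ((Int.castRingHom ℚ).mapMatrix.comp ρ) (fun b' => by rw [hA]; exact frame_reading_map_algebraMap Fr ρ hρ b')
    hθsurj (idempotent_mul_self ε hε₁ hε₀) hε₁ hp (Ideal.absNorm_mem u₀.asIdeal)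
    (a : GL (Fin 2) (FiniteAdeleRing (𝓞 F) F)) hβ Hfam hinj hΛ'
    (fun i v hv π hπ => by rw [hAu]; exact h𝔭 i v hv π hπ) (fun i => by rw [hAu]; exact hcard i) hst L (by rw [hAu]; exact hL)
    (fun v hv π hπ => by rw [hAu]; exact hL𝔭 v hv π hπ) (by rw [hAu]; exact hLcard) hLst

end AuxV

end UnitaryCurve

end Literature.AlgebraicGeometry.ShimuraVarieties

end
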